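import Summits.ABC.IUTFork.Thm311RealInd1StripBaseLine
import HarnessLib

/-!
# [IUTchIII] Thm 3.11 (i) (Ind1) at `v ∈ 𝕍^non`, EVEN local degree — UNIT LEVEL: THE equivariant lift of some automorphism of `G_v`
# carries the `p`-adic units `ℤ_p^× ⊆ 𝒪_v^×` off themselves modulo torsion (Kondo Lemma 2.5 (2) / Hoshi RIMS-1960 Lemma 3.1 (v)
# «`α^×` does not preserve `𝒪^×_{k^{(d=1)}}`»), modulo `JannsenWingbergTwistsFirst`

PROOF-ONLY file (abc-iut cell, Cor. 3.12 sub-crew, seat abc-iut-c312-1 = holder of record of the typed [IUTchIII] Thm. 3.11,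
gen 12; row «R14 FIRST-PLANE TWIST», part f).  TAKES NO SIDE on [IUTchIII] Cor. 3.12.

Kondo, arXiv:2512.09231, Lemma 2.5 (2): «The intersection `φ^×(𝒪^×_{k^{(d=1)}}) ∩ 𝒪^×_{k^{(d=1)}}` is not open in `𝒪^×_{k^{(d=1)}}`»
(`p_k` odd, `d_k` even, `φ(x_2) = x_2x_1`); Hoshi, RIMS-1960 = Kodai Math. J. 47 (2024), Lemma 3.1 (v) at `d_k = 2`.  The log-level form
(the BASE LINE `ℚ_p·1 ⊆ K_v` is moved off itself) is `Thm311RealInd1StripBaseLine` (p502894).  HERE the same at the level print's (Ind1)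
speaks about — the units `𝒪_v^× = O^×(G_v)^{G_v}` and THE equivariant lift `Real.liftUnits v φ : 𝒪_v^× ≃* 𝒪_v^×` ([AbsTopIII] Prop. 3.2 (iv),
abc-iut-c312-1 gen 8 p448652):
* `Real.of_galoisLog_mem_range_of_mem_range` — a `p`-ADIC unit (`u ∈ 𝒪_v^×` in the image of `ℚ_p → K_v`) has a `p`-ADIC logarithm
  (functoriality of `log_p` along the isometric `ℚ_p → K_v^{(1/n_v)}`, abc-iut-S1 `unitLog_map`); so does torsion × `p`-adic;
* `Real.isOfFinOrder_of_galoisLog_eq_zero` — `log u = 0 ⟹ u` torsion (gen 8 `exists_pow_eq_of_galoisLog_eq`);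
* **`Real.exists_liftUnits_padic_inter_padic_subset_torsion_of_jannsenWingbergFirst`** — assume `JannsenWingbergTwistsFirst`; at every
  `v ∣ p` odd with `[K_v : ℚ_p] ≥ 2` EVEN there is `φ ∈ Aut_top(G_v)` such that every `u ∈ 𝒪_v^×` with `log u` AND `log(liftUnits φ u)`
  both `p`-adic is TORSION: `liftUnits φ (ℤ_p^×·μ) ∩ (ℤ_p^×·μ) ⊆ μ` — Kondo's Lemma 2.5 (2) («not open»: a subset of the finite torsion);
* **`Real.liftUnits_uZero_not_mem_of_jannsenWingbergFirst`** — in particular THE lift carries the `p`-adic unit `u₀ = 1 + p_v` (gen 8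
  `Real.uZero`) to a unit that is NOT torsion × `p`-adic: `liftUnits φ u₀ ≠ ζ·w` for every torsion `ζ` and `p`-adic `w`.
Reading for the record (neutral, OUR typed objects, one place): under PRINT's (Ind1) the `𝒟^⊢`-strip automorphisms act on `O^×(G_v)` through
THE equivariant lift and, modulo the named fact, move the `p`-adic units `ℤ_p^× ⊆ 𝒪_v^×` at every even local degree — the unit-level companion
of the base-line statement; print's (Ind2) (`Ẑ^×`-powers / `ℤ_p^×` scalars on logs) maps `ℤ_p^×·μ` into itself.  HONEST SCOPE: conditional on
`JannsenWingbergTwistsFirst`; odd `d` untreated; nothing here asserts or refutes [IUTchIII] Cor. 3.12; NO abc claim.  [claim: Mochizuki2012,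
status: disputed]; [cite: Kondo2025OuterAutMLF, §2 Lemma 2.5 (2)]; [cite: Hoshi2024IntrinsicHodgeTate, Lemma 3.1 (v) pp.10–11];
[cite: HoshiNishio2022OuterAutMLF, Lemma 2.4, Rmk 2.5 p.8]; [cite: MochizukiAbsTopIII2015, Prop 3.2 (iv)].  typed ≠ proved; a conditional theorem
discharges nothing it binds.
-/

set_option autoImplicit false

noncomputable section

open Metric Set
open scoped Pointwise

namespace Summit.ABC.IUTFork.Thm311.Real

open NumberField IsDedekindDomain Literature.NumberTheory.NumberFields Literature.IUT.LogVolume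
open Literature.NumberTheory.GaloisRepresentations
open Literature.AnabelianGeometry.AbsoluteAnabelian Literature.IUT.HodgeArakelov
open Literature.IUT.HodgeArakelov.AbsTopMonoids

variable {F : Type} [Field F] [NumberField F] (v : HeightOneSpectrum (𝓞 F))

/-! ## 1. `p`-adic units have `p`-adic logarithms; `log u = 0` only for torsion -/

section Padic

variable (p : ℕ) [Fact p.Prime] (hv : ((p : ℕ) : 𝓞 F) ∈ v.asIdeal)

/-- **A `p`-adic unit has a `p`-adic logarithm**: if `u ∈ 𝒪_v^×` lies in the image of `ℚ_p → K_v^{(1/n_v)}`, so does `log u` (the Galois =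
analytic logarithm; `log_p` commutes with the ISOMETRIC ring map `ℚ_p → K_v^{(1/n_v)}`, abc-iut-S1 `unitLog_map`). [cite: NeukirchANT1999, Ch. II Prop. (5.5)] -/
theorem of_galoisLog_mem_range_of_mem_range (u : (↥(v.adicCompletionIntegers F))ˣ)
    (hu : RescaledCompletion.of F p v hv (((u : ↥(v.adicCompletionIntegers F)) : v.adicCompletion F)) ∈
      Set.range (algebraMap ℚ_[p] (RescaledCompletion F p v hv))) :
    RescaledCompletion.of F p v hv (galoisLog v (Additive.ofMul u)) ∈ Set.range (algebraMap ℚ_[p] (RescaledCompletion F p v hv)) := by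
  obtain ⟨c, hc⟩ := hu
  rw [galoisLog_apply_eq_unitLog v p hv u, RingEquiv.apply_symm_apply, ← hc,
    unitLog_map p (algebraMap ℚ_[p] (RescaledCompletion F p v hv)) (fun x => norm_algebraMap' _ x) c]
  exact ⟨unitLog c, rfl⟩

/-- Torsion × `p`-adic units have `p`-adic logarithms (`log` kills torsion). [cite: NeukirchANT1999, Ch. II Prop. (5.5)] -/
theorem of_galoisLog_mul_mem_range_of_isOfFinOrder (ζ w : (↥(v.adicCompletionIntegers F))ˣ) (hζ : IsOfFinOrder ζ)
    (hw : RescaledCompletion.of F p v hv (((w : ↥(v.adicCompletionIntegers F)) : v.adicCompletion F)) ∈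
      Set.range (algebraMap ℚ_[p] (RescaledCompletion F p v hv))) :
    RescaledCompletion.of F p v hv (galoisLog v (Additive.ofMul (ζ * w))) ∈ Set.range (algebraMap ℚ_[p] (RescaledCompletion F p v hv)) := by
  haveI : CharZero (v.adicCompletion F) := charZero_adicCompletion v
  have hζ0 : galoisLog v (Additive.ofMul ζ) = 0 := by
    obtain ⟨n, hn, hpow⟩ := hζ.exists_pow_eq_one
    have h1 : (n : v.adicCompletion F) * galoisLog v (Additive.ofMul ζ) = 0 := by
      rw [← nsmul_eq_mul, ← map_nsmul, ← ofMul_pow, hpow, ofMul_one, map_zero]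
    exact (mul_eq_zero.mp h1).resolve_left (by exact_mod_cast hn.ne')
  rw [ofMul_mul, map_add, hζ0, zero_add]
  exact of_galoisLog_mem_range_of_mem_range v p hv w hw

omit [Fact p.Prime] in
/-- **`log u = 0` only for torsion** (gen 8 `exists_pow_eq_of_galoisLog_eq` with `u' = 1`). [cite: NeukirchANT1999, Ch. II Prop. (5.5)] -/
theorem isOfFinOrder_of_galoisLog_eq_zero [Fact (closureAt v).residueChar.Prime] (u : (↥(v.adicCompletionIntegers F))ˣ)
    (hu : galoisLog v (Additive.ofMul u) = 0) : IsOfFinOrder u := by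
  have h : galoisLog v (Additive.ofMul u) = galoisLog v (Additive.ofMul 1) := by rw [hu, ofMul_one, map_zero]
  obtain ⟨n, hn, hpow⟩ := exists_pow_eq_of_galoisLog_eq v h
  rw [one_pow] at hpow
  exact isOfFinOrder_iff_pow_eq_one.mpr ⟨n, hn, hpow⟩

end Padic

/-! ## 2. The lift meets the `p`-adic units only in torsion (Kondo Lemma 2.5 (2)) -/

/-- **KONDO'S LEMMA 2.5 (2) AT THE REAL LOG-SHELL, modulo `JannsenWingbergTwistsFirst`.**  At every finite place `v ∣ p` of a number field with `p`
odd and `[K_v : ℚ_p] ≥ 2` EVEN there is a topological automorphism `φ` of `G_v` such that, for THE equivariant lift `liftUnits v φ` on `𝒪_v^×`: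
every unit `u` whose logarithm AND whose image's logarithm are both `p`-adic (in `range(ℚ_p → K_v^{(1/n_v)})`) is TORSION.  With §1:
`liftUnits φ (μ·ℤ_p^×) ∩ μ·ℤ_p^× ⊆ μ` — «`φ^×(𝒪^×_{k^{(d=1)}}) ∩ 𝒪^×_{k^{(d=1)}}` is not open».  Proof: `φ` realises the first-pair shear `ψ₀`
(p502894: `ψ₀(a·1) ∉ ℚ_p·1` for `a ≠ 0`) through `log`: `log(liftUnits φ u) = ψ₀(log u)`; so `log u = a·1` forces `a = 0`, i.e. `u` torsion.
[claim: Mochizuki2012, status: disputed] [cite: Kondo2025OuterAutMLF, §2 Lemma 2.5 (2)] [cite: Hoshi2024IntrinsicHodgeTate, Lemma 3.1 (v) pp.10–11] -/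
theorem exists_liftUnits_padic_inter_padic_subset_torsion_of_jannsenWingbergFirst (hJW : JannsenWingbergTwistsFirst)
    (p : ℕ) [Fact p.Prime] (hv : ((p : ℕ) : 𝓞 F) ∈ v.asIdeal) (hp2 : p ≠ 2) (h2 : 2 ≤ localDeg F v) (hev : Even (localDeg F v)) :
    ∃ φ : Gal v ≃ₜ* Gal v, ∀ u : (↥(v.adicCompletionIntegers F))ˣ,
      RescaledCompletion.of F p v hv (galoisLog v (Additive.ofMul u)) ∈ Set.range (algebraMap ℚ_[p] (RescaledCompletion F p v hv)) →
      RescaledCompletion.of F p v hv (galoisLog v (Additive.ofMul (liftUnits v φ u))) ∈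
        Set.range (algebraMap ℚ_[p] (RescaledCompletion F p v hv)) →
      IsOfFinOrder u := by
  haveI : Fact (closureAt v).residueChar.Prime := (closureAt v).fact_residueChar_prime
  obtain ⟨ψ₀, hψ₀, hmove⟩ := apply_algebraMap_not_mem_range_of_jannsenWingbergFirst v hJW p hv hp2 h2 hev
  obtain ⟨-, -, φ, hφ⟩ := hψ₀
  rw [realises_stripMulAut_iff] at hφ
  refine ⟨φ, fun u hu hlift => ?_⟩
  obtain ⟨a, ha⟩ := hu
  by_cases ha0 : a = 0
  · -- `log u = 0`
    apply isOfFinOrder_of_galoisLog_eq_zero v u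
    apply (RescaledCompletion.of F p v hv).injective
    rw [← ha, ha0, map_zero, map_zero]
  · -- `log u = a·1`, `a ≠ 0`: `ψ₀(a·1) = log(liftUnits φ u)` would be `p`-adic
    exfalso
    refine hmove 1 one_ne_zero a ha0 ?_
    rw [one_nsmul, ha, RingEquiv.symm_apply_apply, hφ u]
    exact hlift

/-! ## 3. The `p`-adic unit `1 + p_v` is carried off `μ·ℤ_p^×` -/

/-- `u₀ = 1 + p_v` is a `p`-adic unit: `of(u₀) = algebraMap (1 + p_v)`. [folklore] -/
theorem of_coe_uZero [Fact (closureAt v).residueChar.Prime] :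
    RescaledCompletion.of F (closureAt v).residueChar v (natCast_residueChar_closureAt_mem v)
        (((uZero v : ↥(v.adicCompletionIntegers F)) : v.adicCompletion F)) =
      algebraMap ℚ_[(closureAt v).residueChar] (RescaledCompletion F (closureAt v).residueChar v (natCast_residueChar_closureAt_mem v))
        (((sZero v : ℤ_[(closureAt v).residueChar]ˣ) : ℤ_[(closureAt v).residueChar]) : ℚ_[(closureAt v).residueChar]) := by
  rw [coe_uZero, RescaledCompletion.algebraMap_eq]
  rfl

/-- `u₀ = 1 + p_v` is NOT torsion (its norm `(1 + p_v)^{n_v}` is not, gen 8 `not_isOfFinOrder_normUnits_uZero`). [folklore] -/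
theorem not_isOfFinOrder_uZero [Fact (closureAt v).residueChar.Prime] : ¬ IsOfFinOrder (uZero v) := fun h =>
  not_isOfFinOrder_normUnits_uZero v ((normUnits v).isOfFinOrder h)

/-- **THE LIFT CARRIES `1 + p_v` OFF `μ·ℤ_p^×`** (Kondo Lemma 2.5 (2) / Hoshi Lemma 3.1 (v), concrete form), modulo `JannsenWingbergTwistsFirst`:
at every `v ∣ p` odd with `[K_v : ℚ_p] ≥ 2` EVEN some `φ ∈ Aut_top(G_v)` has `liftUnits v φ u₀ ≠ ζ·w` for EVERY torsion `ζ ∈ 𝒪_v^×` and every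
`p`-adic unit `w` (`w ∈ 𝒪_v^×` in the image of `ℚ_p`), where `u₀ = 1 + p_v ∈ ℤ_p^×`.  So print's (Ind1) strip part, acting on `O^×(G_v)^{G_v} = 𝒪_v^×`
through THE equivariant lift, does NOT preserve `μ·ℤ_p^× ⊆ 𝒪_v^×` («`𝒪^×_{k^{(d=1)}} ⊆ 𝒪_k^×` is not group-theoretic», Hoshi Rmk. 3.1.1).
[claim: Mochizuki2012, status: disputed] [cite: Kondo2025OuterAutMLF, §2 Lemma 2.5 (2)] [cite: Hoshi2024IntrinsicHodgeTate, Lemma 3.1 (v) pp.10–11] -/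
theorem liftUnits_uZero_not_mem_of_jannsenWingbergFirst (hJW : JannsenWingbergTwistsFirst) [Fact (closureAt v).residueChar.Prime]
    (hp2 : (closureAt v).residueChar ≠ 2) (h2 : 2 ≤ localDeg F v) (hev : Even (localDeg F v)) :
    ∃ φ : Gal v ≃ₜ* Gal v, ∀ ζ w : (↥(v.adicCompletionIntegers F))ˣ, IsOfFinOrder ζ →
      RescaledCompletion.of F (closureAt v).residueChar v (natCast_residueChar_closureAt_mem v)
          (((w : ↥(v.adicCompletionIntegers F)) : v.adicCompletion F)) ∈
        Set.range (algebraMap ℚ_[(closureAt v).residueChar]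
          (RescaledCompletion F (closureAt v).residueChar v (natCast_residueChar_closureAt_mem v))) →
      liftUnits v φ (uZero v) ≠ ζ * w := by
  set hv := natCast_residueChar_closureAt_mem v
  obtain ⟨φ, hφ⟩ :=
    exists_liftUnits_padic_inter_padic_subset_torsion_of_jannsenWingbergFirst v hJW (closureAt v).residueChar hv hp2 h2 hev
  refine ⟨φ, fun ζ w hζ hw heq => not_isOfFinOrder_uZero v (hφ (uZero v) ?_ ?_)⟩
  · exact of_galoisLog_mem_range_of_mem_range v (closureAt v).residueChar hv (uZero v) ⟨_, (of_coe_uZero v).symm⟩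
  · rw [heq]
    exact of_galoisLog_mul_mem_range_of_isOfFinOrder v (closureAt v).residueChar hv ζ w hζ hw

end Summit.ABC.IUTFork.Thm311.Real

end
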